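import Summits.AtomisticToContinuum.HydrodynamicLimit.Theorems.CollisionIsometryCLTMacroClosureEngineInitial
import Summits.AtomisticToContinuum.HydrodynamicLimit.Theorems.CollisionIsometryCLTMacroClosureStubClausiusCore
import HarnessLib

/-!
# Sub-goal `engine_entropyLedger` of the lead's stub `stub_engine` (line `IdeatorTwoGen1Sketch`, crux
# `MacroClosure`, stmt-AtomisticToContinuum-14870), part A: the entropy ledger at fixed `N` and `s`

Support file (`--supports stmt-AtomisticToContinuum-14870`) for the registered sub-goal
`Barycentric.engine_entropyLedger` (hypothesis (a) of the abstract Gronwall `engine_core`).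

Fix `N`, a flow `Φ`, a time `s`, a continuous kernel `φ ≥ 0` of mass one bounded by `Φb < (N+1)c₁`,
`f_ex` continuous on the band packings `[c₁σ³, 1]`, a measurable good event `G ⊆ good` whose time-`s`
images lie in the band `c₁ ≤ ρ̄ ≤ σ⁻³`, the classical state `U_s = Ucl ρ θ u s` with entropy variables
`Λ_s = Lcl σ ρ θ u s` of the explicit form `Λ_s(x) V = λ⁰ V.1 + Σⱼ λᵐⱼ V.2.1 j + λᴱ V.2.2` (bounded continuous
weights), an observable commutator bound `|∫ₓ Λ_s·Ū(w) − Obs(s,w)| ≤ K ⟨emp w, 1 + |v|²⟩`, a second moment of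
the per-particle kinetic energy `e` under `P = localGibbsLaw σ a₀ u₀ θ₀ N Φ`, and integrability of
`𝟙_G ∫ₓ η_σ(Ū(Φ_s z, x)) dx` (Clausius). Then (`EngineEntropyLedger.ledger_fixed`):

* `𝟙_G ∫ₓ h_σ(Ū(Φ_s z,x) | U_s(x)) dx` and `𝟙_G (Obs(s, Φ_s z) − ∫ₓ Λ_s·U_s)` are `P`-integrable, and
* `E[𝟙_G ∫ₓ h_σ(Ū|U_s)] + E[𝟙_G (Obs − ∫ₓΛ_s·U_s)] ≤ E[𝟙_G ∫ₓ η_σ(Ū)] − P(G) ∫ₓ η_σ(U_s) + K (1 + 2(M₀ + 1))`.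

Proof: `P`-almost surely the velocities of `Φ_s z` are pairwise distinct (`Clausius.ae_pairwise_vel_ne`), so on
`G` every block carries two particles with distinct velocities and `x ↦ η_σ(Ū(Φ_s z, x))` is continuous
(`Clausius.core_pointwise`); the BREGMAN TELESCOPE `h_σ(Ū|U) = η_σ(Ū) − η_σ(U) − Λ·Ū + Λ·U` then integrates
term by term (`integral_relEnt_eq`), the `Λ·U_s` terms cancel against the observable's centring, the commutator
bound and conservation of `e` along good orbits (`Clausius.totals_flow`) control `Obs − ∫Λ·Ū` by `K(1 + 2e)`,
and `E[e] ≤ M₀ + 1`. Measurability of `z ↦ ∫ₓ Λ_s·Ū(Φ_s z)` comes from the explicit form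
(`measurable_integral_pairing`), that of `Obs` from `EngineInitial.measurable_obs`.
-/

noncomputable section

open MeasureTheory Filter Set Topology InformationTheory
open scoped ENNReal ContDiff

namespace Summit.AtomisticToContinuum.HydrodynamicLimit.Theorems.MacroClosureLine

open Literature.MathematicalPhysics.KineticTheory Literature.Analysis.FluidPDE
open Literature.Analysis.FunctionSpaces

namespace Barycentric

namespace EngineEntropyLedger

/-! ## Elementary limits -/

/-- Vanishing probabilities, in real form: `P_N(G_Nᶜ) → 0` gives `P_N.real (G_Nᶜ) ≤ ε` eventually. -/
theorem eventually_real_le {Ω : ℕ → Type*} [∀ N, MeasurableSpace (Ω N)] {P : (N : ℕ) → Measure (Ω N)}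
    {G : (N : ℕ) → Set (Ω N)} (hGc : Tendsto (fun N => P N (G N)ᶜ) atTop (𝓝 0)) {ε : ℝ} (hε : 0 < ε) :
    ∀ᶠ N in atTop, (P N).real (G N)ᶜ ≤ ε := by
  have h := ENNReal.tendsto_nhds_zero.1 hGc (ENNReal.ofReal ε) (ENNReal.ofReal_pos.2 hε)
  filter_upwards [h] with N hN
  exact ENNReal.toReal_le_of_le_ofReal hε.le hN

variable {N : ℕ}

/-! ## Kinetic energy: the commutator weight and the first moment -/

/-- `⟨emp w, 1 + |v|²⟩ = 1 + 2 e(w)` with the per-particle kinetic energy `e = ⟨emp, |v|²/2⟩`. -/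
theorem kinetic_weight_eq (w : Config (N + 1) (Fin 3) T3) :
    ∫ y, (1 + ‖y.2‖ ^ 2) ∂(empiricalMeasure w) = 1 + 2 * empiricalEnergyField w fun _ => (1 : ℝ) := by
  rw [integral_empiricalMeasure, Clausius.empiricalEnergyField_one, Finset.sum_add_distrib,
    Finset.sum_const, Finset.card_univ, Fintype.card_fin, nsmul_eq_mul, mul_one, ← Finset.sum_div]
  have hN : ((N + 1 : ℕ) : ℝ) ≠ 0 := by positivity
  rw [mul_add, inv_mul_cancel₀ hN]
  ring

/-- From the second to the first moment of the per-particle kinetic energy (`e ≤ e² + 1`). -/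
theorem integral_energy_le {P : Measure (Config (N + 1) (Fin 3) T3)} [IsProbabilityMeasure P] {M₀ : ℝ}
    (he2 : Integrable (fun z => (empiricalEnergyField z fun _ => (1 : ℝ)) ^ 2) P)
    (hM₀ : ∫ z, (empiricalEnergyField z fun _ => (1 : ℝ)) ^ 2 ∂P ≤ M₀) :
    Integrable (fun z => empiricalEnergyField z fun _ => (1 : ℝ)) P ∧
      ∫ z, (empiricalEnergyField z fun _ => (1 : ℝ)) ∂P ≤ M₀ + 1 := by
  have hmeas := Clausius.measurable_energy_one N
  have hdom : ∀ z : Config (N + 1) (Fin 3) T3, (empiricalEnergyField z fun _ => (1 : ℝ)) ≤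
      (empiricalEnergyField z fun _ => (1 : ℝ)) ^ 2 + 1 := fun z => by
    nlinarith [sq_nonneg ((empiricalEnergyField z fun _ => (1 : ℝ)) - 1),
      Clausius.empiricalEnergyField_one_nonneg z]
  have hgi : Integrable (fun z => (empiricalEnergyField z fun _ => (1 : ℝ)) ^ 2 + 1) P :=
    he2.add (integrable_const _)
  have hInt : Integrable (fun z => empiricalEnergyField z fun _ => (1 : ℝ)) P := by
    refine hgi.mono' hmeas.aestronglyMeasurable (Eventually.of_forall fun z => ?_)
    rw [Real.norm_eq_abs, abs_of_nonneg (Clausius.empiricalEnergyField_one_nonneg z)]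
    exact hdom z
  refine ⟨hInt, ?_⟩
  calc ∫ z, (empiricalEnergyField z fun _ => (1 : ℝ)) ∂P
      ≤ ∫ z, ((empiricalEnergyField z fun _ => (1 : ℝ)) ^ 2 + 1) ∂P := integral_mono hInt hgi hdom
    _ = (∫ z, (empiricalEnergyField z fun _ => (1 : ℝ)) ^ 2 ∂P) + 1 := by
        rw [integral_add he2 (integrable_const _), integral_const, smul_eq_mul, probReal_univ, one_mul]
    _ ≤ M₀ + 1 := by linarith

/-! ## The linear pairing `∫ₓ Λ_s·Ū`: measurability; the Bregman telescope -/

/-- **Measurability of the linear block pairing**: for continuous weights `λ⁰, λᵐ, λᴱ` and a continuous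
kernel, `w ↦ ∫ₓ (λ⁰ ρ̄ + Σⱼ λᵐⱼ m̄ⱼ + λᴱ Ē)(w, x) dx` is measurable (joint measurability of the block
fields, `Clausius.measurable_bU_prod`, and `StronglyMeasurable.integral_prod_right'`). -/
theorem measurable_integral_pairing {l0 lE : T3 → ℝ} {lM : T3 → V3} (h0 : Continuous l0)
    (hM : Continuous lM) (hE : Continuous lE) {φ : T3 → ℝ} (hφc : Continuous φ) :
    Measurable fun w : Config (N + 1) (Fin 3) T3 =>
      ∫ x, (l0 x * bρ φ w x + (∑ j, lM x j * bm φ w x j) + lE x * bE φ w x) := by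
  have hb := Clausius.measurable_bU_prod (N := N) hφc
  have hρ : Measurable fun p : Config (N + 1) (Fin 3) T3 × T3 => bρ φ p.1 p.2 := hb.fst
  have hm : Measurable fun p : Config (N + 1) (Fin 3) T3 × T3 => bm φ p.1 p.2 := hb.snd.fst
  have hEn : Measurable fun p : Config (N + 1) (Fin 3) T3 × T3 => bE φ p.1 p.2 := hb.snd.snd
  have hvj : ∀ j : Fin 3, Measurable fun v : V3 => v j := fun j =>
    (PiLp.continuous_apply 2 _ j).measurable
  have hj : Measurable fun p : Config (N + 1) (Fin 3) T3 × T3 =>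
      l0 p.2 * bρ φ p.1 p.2 + (∑ j, lM p.2 j * bm φ p.1 p.2 j) + lE p.2 * bE φ p.1 p.2 := by
    refine (((h0.measurable.comp measurable_snd).mul hρ).add
      (Finset.measurable_sum _ fun j _ => ?_)).add ((hE.measurable.comp measurable_snd).mul hEn)
    exact ((hvj j).comp (hM.measurable.comp measurable_snd)).mul ((hvj j).comp hm)
  exact (hj.stronglyMeasurable.integral_prod_right' (ν := volume)).measurable

/-- **The Bregman telescope, integrated.** If `x ↦ η_σ(Ū(w,x))` is continuous (band configuration with two
distinct velocities per block) and the classical data at time `s` are continuous, then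
`∫ₓ h_σ(Ū | U_s) = ∫ₓ η_σ(Ū) − ∫ₓ η_σ(U_s) − ∫ₓ Λ_s·Ū + ∫ₓ Λ_s·U_s`. -/
theorem integral_relEnt_eq {σ : ℝ} {ρ θ : ℝ → T3 → ℝ} {u : ℝ → T3 → V3} {s : ℝ}
    (hΛc : Continuous (Lcl σ ρ θ u s)) (hUc : Continuous (Ucl ρ θ u s))
    (hηU : Continuous fun x => hsEntropy σ (Ucl ρ θ u s x)) {φ : T3 → ℝ} (hφc : Continuous φ)
    (w : Config (N + 1) (Fin 3) T3) (hηw : Continuous fun x => hsEntropy σ (bU φ w x)) :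
    ∫ x, relEnt σ (bU φ w x) (Ucl ρ θ u s x) =
      (∫ x, hsEntropy σ (bU φ w x)) - (∫ x, hsEntropy σ (Ucl ρ θ u s x)) -
        (∫ x, Lcl σ ρ θ u s x (bU φ w x)) + ∫ x, Lcl σ ρ θ u s x (Ucl ρ θ u s x) := by
  have hbU : Continuous fun x => bU φ w x :=
    (Clausius.continuous_bρ hφc w).prodMk
      ((Clausius.continuous_bm hφc w).prodMk (Clausius.continuous_bE hφc w))
  have h1 : Continuous fun x => Lcl σ ρ θ u s x (bU φ w x) := hΛc.clm_apply hbU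
  have h2 : Continuous fun x => Lcl σ ρ θ u s x (Ucl ρ θ u s x) := hΛc.clm_apply hUc
  have hpt : ∀ x, relEnt σ (bU φ w x) (Ucl ρ θ u s x) =
      (hsEntropy σ (bU φ w x) - hsEntropy σ (Ucl ρ θ u s x)) -
        (Lcl σ ρ θ u s x (bU φ w x) - Lcl σ ρ θ u s x (Ucl ρ θ u s x)) := by
    intro x
    simp only [relEnt, Lcl, map_sub]
  have iA : Integrable fun x => hsEntropy σ (bU φ w x) - hsEntropy σ (Ucl ρ θ u s x) :=
    (integrable_of_continuous_T3 hηw).sub (integrable_of_continuous_T3 hηU)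
  have iB : Integrable fun x => Lcl σ ρ θ u s x (bU φ w x) - Lcl σ ρ θ u s x (Ucl ρ θ u s x) :=
    (integrable_of_continuous_T3 h1).sub (integrable_of_continuous_T3 h2)
  simp_rw [hpt]
  rw [integral_sub iA iB, integral_sub (integrable_of_continuous_T3 hηw) (integrable_of_continuous_T3 hηU),
    integral_sub (integrable_of_continuous_T3 h1) (integrable_of_continuous_T3 h2)]
  ring

/-! ## The ledger at fixed `N` and `s` -/

/-- **The entropy ledger at fixed `N` and `s`.** See the module docstring: integrability of
`𝟙_G ∫ₓ h_σ(Ū|U_s)` and of `𝟙_G (Obs − ∫ₓ Λ_s·U_s)`, and the bound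
`E[𝟙_G ∫ₓ h_σ(Ū|U_s)] + E[𝟙_G (Obs − ∫ₓΛ_s·U_s)] ≤ E[𝟙_G ∫ₓ η_σ(Ū)] − P(G) ∫ₓ η_σ(U_s) + K (1 + 2(M₀ + 1))`. -/
theorem ledger_fixed {σ : ℝ} (hσ : 0 < σ) (hσ2 : σ ≤ 1 / 2) {a₀ θ₀ : T3 → ℝ} {u₀ : T3 → V3}
    (ha : Continuous a₀) (hθ : Continuous θ₀) (hu : Continuous u₀) (ha0 : ∀ x, 0 < a₀ x)
    (hθ0 : ∀ x, 0 < θ₀ x) {ρ θ : ℝ → T3 → ℝ} {u : ℝ → T3 → V3} {s : ℝ}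
    (hL : ∀ (x : T3) (V : State), Lcl σ ρ θ u s x V =
      lam0 σ ρ θ u s x * V.1 + (∑ j, lamM θ u s x j * V.2.1 j) + lamE θ s x * V.2.2)
    (hΛc : Continuous (Lcl σ ρ θ u s)) (hUc : Continuous (Ucl ρ θ u s))
    (hηU : Continuous fun x => hsEntropy σ (Ucl ρ θ u s x))
    (h0c : Continuous (lam0 σ ρ θ u s)) (hMc : Continuous (lamM θ u s)) (hEc : Continuous (lamE θ s))
    {A0 AM AE : ℝ} (hA0 : ∀ x, |lam0 σ ρ θ u s x| ≤ A0) (hAM : ∀ x j, |lamM θ u s x j| ≤ AM)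
    (hAE : ∀ x, |lamE θ s x| ≤ AE)
    (Φ : Flow σ N) {φ : T3 → ℝ} (hφc : Continuous φ) (hφ0 : ∀ y, 0 ≤ φ y) (hφ1 : ∫ y, φ y = 1)
    {Φb c₁ : ℝ} (hφb : ∀ y, φ y ≤ Φb) (hN : Φb < ((N + 1 : ℕ) : ℝ) * c₁) (hc₁ : 0 < c₁)
    (hfex : ContinuousOn hsExcessFreeEnergy (Icc (c₁ * σ ^ 3) 1))
    {G : Set (Config (N + 1) (Fin 3) T3)} (hGm : MeasurableSet G) (hGgood : G ⊆ Φ.good)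
    (hGband : ∀ z ∈ G, ∀ x, c₁ ≤ bρ φ (Φ.flow s z) x ∧ bρ φ (Φ.flow s z) x * σ ^ 3 ≤ 1)
    {K : ℝ} (hK : 0 ≤ K)
    (hcomm : ∀ w : Config (N + 1) (Fin 3) T3,
      |(∫ x, Lcl σ ρ θ u s x (bU φ w x)) - obs σ ρ θ u s w| ≤
        K * ∫ y, (1 + ‖y.2‖ ^ 2) ∂(empiricalMeasure w))
    {M₀ : ℝ}
    (he2 : Integrable (fun z => (empiricalEnergyField z fun _ => (1 : ℝ)) ^ 2)
      (localGibbsLaw σ a₀ u₀ θ₀ N Φ))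
    (hM₀ : ∫ z, (empiricalEnergyField z fun _ => (1 : ℝ)) ^ 2 ∂(localGibbsLaw σ a₀ u₀ θ₀ N Φ) ≤ M₀)
    (hIint : Integrable (fun z => G.indicator (fun z => ∫ x, hsEntropy σ (bU φ (Φ.flow s z) x)) z)
      (localGibbsLaw σ a₀ u₀ θ₀ N Φ)) :
    Integrable (fun z => G.indicator
        (fun z => ∫ x, relEnt σ (bU φ (Φ.flow s z) x) (Ucl ρ θ u s x)) z) (localGibbsLaw σ a₀ u₀ θ₀ N Φ) ∧
    Integrable (fun z => G.indicator
        (fun z => obs σ ρ θ u s (Φ.flow s z) - ∫ x, Lcl σ ρ θ u s x (Ucl ρ θ u s x)) z)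
      (localGibbsLaw σ a₀ u₀ θ₀ N Φ) ∧
    (∫ z, G.indicator (fun z => ∫ x, relEnt σ (bU φ (Φ.flow s z) x) (Ucl ρ θ u s x)) z
        ∂(localGibbsLaw σ a₀ u₀ θ₀ N Φ)) +
      ∫ z, G.indicator (fun z => obs σ ρ θ u s (Φ.flow s z) - ∫ x, Lcl σ ρ θ u s x (Ucl ρ θ u s x)) z
        ∂(localGibbsLaw σ a₀ u₀ θ₀ N Φ) ≤
      (∫ z, G.indicator (fun z => ∫ x, hsEntropy σ (bU φ (Φ.flow s z) x)) z
          ∂(localGibbsLaw σ a₀ u₀ θ₀ N Φ)) -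
        (localGibbsLaw σ a₀ u₀ θ₀ N Φ).real G * (∫ x, hsEntropy σ (Ucl ρ θ u s x)) +
        K * (1 + 2 * (M₀ + 1)) := by
  haveI hP : IsProbabilityMeasure (localGibbsLaw σ a₀ u₀ θ₀ N Φ) :=
    isProbabilityMeasure_localGibbsLaw ha hθ hu ha0 hθ0 hσ2 N Φ
  have hTm : Measurable (Φ.flow s) := Φ.measurable_flow s
  have hA00 : 0 ≤ A0 := (abs_nonneg _).trans (hA0 0)
  have hAM0 : 0 ≤ AM := (abs_nonneg _).trans (hAM 0 0)
  have hAE0 : 0 ≤ AE := (abs_nonneg _).trans (hAE 0)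
  -- the per-particle kinetic energy: non-negative, conserved on `G`, first moment
  have he0 : ∀ z : Config (N + 1) (Fin 3) T3, 0 ≤ empiricalEnergyField z fun _ => (1 : ℝ) := fun z =>
    Clausius.empiricalEnergyField_one_nonneg z
  obtain ⟨heInt, heM⟩ := integral_energy_le he2 hM₀
  have heG : ∀ z ∈ G, (empiricalEnergyField (Φ.flow s z) fun _ => (1 : ℝ)) =
      empiricalEnergyField z fun _ => (1 : ℝ) := fun z hz => (Clausius.totals_flow Φ (hGgood hz) s).2
  -- the observable: measurable, affine in the energy on `G`
  have hOm : Measurable fun z => obs σ ρ θ u s (Φ.flow s z) :=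
    (EngineInitial.measurable_obs h0c hMc hEc N).comp hTm
  have hObd : ∀ z ∈ G, |obs σ ρ θ u s (Φ.flow s z)| ≤
      (A0 + 3 * AM / 2) + (3 * AM + AE) * empiricalEnergyField z fun _ => (1 : ℝ) := by
    intro z hz
    have h := EngineInitial.abs_obs_le hA0 hAM hAE (Φ.flow s z)
    rwa [heG z hz] at h
  -- the linear pairing `J z = ∫ₓ Λ_s·Ū(Φ_s z)`: measurable, close to the observable on `G`
  have hJm : Measurable fun z => ∫ x, Lcl σ ρ θ u s x (bU φ (Φ.flow s z) x) := by
    have hJ' : (fun z => ∫ x, Lcl σ ρ θ u s x (bU φ (Φ.flow s z) x)) = fun z =>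
        ∫ x, (lam0 σ ρ θ u s x * bρ φ (Φ.flow s z) x +
          (∑ j, lamM θ u s x j * bm φ (Φ.flow s z) x j) + lamE θ s x * bE φ (Φ.flow s z) x) := by
      funext z
      simp only [hL]
      rfl
    rw [hJ']
    exact (measurable_integral_pairing h0c hMc hEc hφc).comp hTm
  have hJO : ∀ z ∈ G, |(∫ x, Lcl σ ρ θ u s x (bU φ (Φ.flow s z) x)) - obs σ ρ θ u s (Φ.flow s z)| ≤
      K * (1 + 2 * empiricalEnergyField z fun _ => (1 : ℝ)) := by
    intro z hz
    have h := hcomm (Φ.flow s z)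
    rwa [kinetic_weight_eq, heG z hz] at h
  -- almost surely: distinct velocities, hence the Bregman telescope on `G`
  have hae : ∀ᵐ z ∂(localGibbsLaw σ a₀ u₀ θ₀ N Φ), z ∈ G →
      ∫ x, relEnt σ (bU φ (Φ.flow s z) x) (Ucl ρ θ u s x) =
        (∫ x, hsEntropy σ (bU φ (Φ.flow s z) x)) - (∫ x, hsEntropy σ (Ucl ρ θ u s x)) -
          (∫ x, Lcl σ ρ θ u s x (bU φ (Φ.flow s z) x)) + ∫ x, Lcl σ ρ θ u s x (Ucl ρ θ u s x) := by
    filter_upwards [Clausius.ae_pairwise_vel_ne a₀ u₀ θ₀ Φ s] with z hz hzG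
    have hcont := (Clausius.core_pointwise hσ hc₁ hfex hφc hφ0 hφ1 hφb hN 0 (Φ.flow s z)
      (hGband z hzG) hz).1
    exact integral_relEnt_eq hΛc hUc hηU hφc (Φ.flow s z) hcont
  -- integrability of `𝟙_G (Obs − ∫Λ·U)`
  have hBm : Measurable fun z => G.indicator
      (fun z => obs σ ρ θ u s (Φ.flow s z) - ∫ x, Lcl σ ρ θ u s x (Ucl ρ θ u s x)) z :=
    (hOm.sub measurable_const).indicator hGm
  have hBint : Integrable (fun z => G.indicator
      (fun z => obs σ ρ θ u s (Φ.flow s z) - ∫ x, Lcl σ ρ θ u s x (Ucl ρ θ u s x)) z)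
      (localGibbsLaw σ a₀ u₀ θ₀ N Φ) := by
    refine Integrable.mono'
      ((integrable_const (A0 + 3 * AM / 2 + |∫ x, Lcl σ ρ θ u s x (Ucl ρ θ u s x)|)).add
        (heInt.const_mul (3 * AM + AE))) hBm.aestronglyMeasurable (ae_of_all _ fun z => ?_)
    rw [Real.norm_eq_abs, Pi.add_apply]
    by_cases hz : z ∈ G
    · rw [indicator_of_mem hz]
      have h1 := hObd z hz
      have h2 := abs_sub (obs σ ρ θ u s (Φ.flow s z)) (∫ x, Lcl σ ρ θ u s x (Ucl ρ θ u s x))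
      linarith
    · rw [indicator_of_notMem hz, abs_zero]
      have := he0 z
      positivity
  -- integrability of `𝟙_G J`
  have hJGint : Integrable (fun z => G.indicator
      (fun z => ∫ x, Lcl σ ρ θ u s x (bU φ (Φ.flow s z) x)) z) (localGibbsLaw σ a₀ u₀ θ₀ N Φ) := by
    refine Integrable.mono' ((integrable_const (A0 + 3 * AM / 2 + K)).add
      (heInt.const_mul (3 * AM + AE + 2 * K))) (hJm.indicator hGm).aestronglyMeasurable
      (ae_of_all _ fun z => ?_)
    rw [Real.norm_eq_abs, Pi.add_apply]
    by_cases hz : z ∈ G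
    · rw [indicator_of_mem hz]
      have h1 := hObd z hz
      have h2 := hJO z hz
      have h3 := abs_add_le ((∫ x, Lcl σ ρ θ u s x (bU φ (Φ.flow s z) x)) - obs σ ρ θ u s (Φ.flow s z))
        (obs σ ρ θ u s (Φ.flow s z))
      rw [sub_add_cancel] at h3
      nlinarith [he0 z]
    · rw [indicator_of_notMem hz, abs_zero]
      have := he0 z
      positivity
  -- `𝟙_G ∫ h_σ(Ū|U)` is a.e. a combination of integrable functions
  have hRae : (fun z => G.indicator (fun z => ∫ x, relEnt σ (bU φ (Φ.flow s z) x) (Ucl ρ θ u s x)) z)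
      =ᵐ[localGibbsLaw σ a₀ u₀ θ₀ N Φ] fun z =>
        G.indicator (fun z => ∫ x, hsEntropy σ (bU φ (Φ.flow s z) x)) z -
          G.indicator (fun z => ∫ x, Lcl σ ρ θ u s x (bU φ (Φ.flow s z) x)) z -
          G.indicator (fun _ => (∫ x, hsEntropy σ (Ucl ρ θ u s x)) -
            ∫ x, Lcl σ ρ θ u s x (Ucl ρ θ u s x)) z := by
    filter_upwards [hae] with z hz
    by_cases hzG : z ∈ G
    · simp only [indicator_of_mem hzG, hz hzG]
      ring
    · simp only [indicator_of_notMem hzG, sub_zero]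
  have hcint : Integrable (fun z => G.indicator (fun _ => (∫ x, hsEntropy σ (Ucl ρ θ u s x)) -
      ∫ x, Lcl σ ρ θ u s x (Ucl ρ θ u s x)) z) (localGibbsLaw σ a₀ u₀ θ₀ N Φ) :=
    (integrable_const _).indicator hGm
  have hRint : Integrable (fun z => G.indicator
      (fun z => ∫ x, relEnt σ (bU φ (Φ.flow s z) x) (Ucl ρ θ u s x)) z) (localGibbsLaw σ a₀ u₀ θ₀ N Φ) :=
    ((hIint.sub hJGint).sub hcint).congr hRae.symm
  refine ⟨hRint, hBint, ?_⟩
  -- the bound: pointwise a.e., then integrate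
  have hSint : Integrable (fun z => G.indicator (fun _ => ∫ x, hsEntropy σ (Ucl ρ θ u s x)) z)
      (localGibbsLaw σ a₀ u₀ θ₀ N Φ) := (integrable_const _).indicator hGm
  have hISint : Integrable (fun z => G.indicator (fun z => ∫ x, hsEntropy σ (bU φ (Φ.flow s z) x)) z -
      G.indicator (fun _ => ∫ x, hsEntropy σ (Ucl ρ θ u s x)) z) (localGibbsLaw σ a₀ u₀ θ₀ N Φ) :=
    hIint.sub hSint
  have hKint : Integrable (fun z => K * (1 + 2 * empiricalEnergyField z fun _ => (1 : ℝ)))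
      (localGibbsLaw σ a₀ u₀ θ₀ N Φ) :=
    ((integrable_const (1 : ℝ)).add (heInt.const_mul 2)).const_mul K
  have hsum : ∀ᵐ z ∂(localGibbsLaw σ a₀ u₀ θ₀ N Φ),
      G.indicator (fun z => ∫ x, relEnt σ (bU φ (Φ.flow s z) x) (Ucl ρ θ u s x)) z +
        G.indicator (fun z => obs σ ρ θ u s (Φ.flow s z) - ∫ x, Lcl σ ρ θ u s x (Ucl ρ θ u s x)) z ≤
      G.indicator (fun z => ∫ x, hsEntropy σ (bU φ (Φ.flow s z) x)) z -
        G.indicator (fun _ => ∫ x, hsEntropy σ (Ucl ρ θ u s x)) z +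
        K * (1 + 2 * empiricalEnergyField z fun _ => (1 : ℝ)) := by
    filter_upwards [hae] with z hz
    by_cases hzG : z ∈ G
    · simp only [indicator_of_mem hzG, hz hzG]
      have h2 := (abs_le.1 (hJO z hzG)).1
      linarith
    · simp only [indicator_of_notMem hzG, add_zero, sub_zero]
      have := he0 z
      positivity
  calc (∫ z, G.indicator (fun z => ∫ x, relEnt σ (bU φ (Φ.flow s z) x) (Ucl ρ θ u s x)) z
          ∂(localGibbsLaw σ a₀ u₀ θ₀ N Φ)) +
        ∫ z, G.indicator (fun z => obs σ ρ θ u s (Φ.flow s z) - ∫ x, Lcl σ ρ θ u s x (Ucl ρ θ u s x)) z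
          ∂(localGibbsLaw σ a₀ u₀ θ₀ N Φ)
      = ∫ z, (G.indicator (fun z => ∫ x, relEnt σ (bU φ (Φ.flow s z) x) (Ucl ρ θ u s x)) z +
          G.indicator (fun z => obs σ ρ θ u s (Φ.flow s z) - ∫ x, Lcl σ ρ θ u s x (Ucl ρ θ u s x)) z)
          ∂(localGibbsLaw σ a₀ u₀ θ₀ N Φ) := (integral_add hRint hBint).symm
    _ ≤ ∫ z, (G.indicator (fun z => ∫ x, hsEntropy σ (bU φ (Φ.flow s z) x)) z -
          G.indicator (fun _ => ∫ x, hsEntropy σ (Ucl ρ θ u s x)) z +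
          K * (1 + 2 * empiricalEnergyField z fun _ => (1 : ℝ))) ∂(localGibbsLaw σ a₀ u₀ θ₀ N Φ) :=
        integral_mono_ae (hRint.add hBint) (hISint.add hKint) hsum
    _ = (∫ z, G.indicator (fun z => ∫ x, hsEntropy σ (bU φ (Φ.flow s z) x)) z
            ∂(localGibbsLaw σ a₀ u₀ θ₀ N Φ)) -
          (localGibbsLaw σ a₀ u₀ θ₀ N Φ).real G * (∫ x, hsEntropy σ (Ucl ρ θ u s x)) +
          K * (1 + 2 * ∫ z, (empiricalEnergyField z fun _ => (1 : ℝ)) ∂(localGibbsLaw σ a₀ u₀ θ₀ N Φ)) := by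
        rw [integral_add hISint hKint, integral_sub hIint hSint, integral_indicator_const _ hGm,
          integral_const_mul, integral_add (integrable_const _) (heInt.const_mul 2), integral_const_mul,
          integral_const, smul_eq_mul, smul_eq_mul, probReal_univ, one_mul]
    _ ≤ _ := by
        have h := mul_le_mul_of_nonneg_left
          (by linarith : (1 : ℝ) + 2 * ∫ z, (empiricalEnergyField z fun _ => (1 : ℝ))
            ∂(localGibbsLaw σ a₀ u₀ θ₀ N Φ) ≤ 1 + 2 * (M₀ + 1)) hK
        linarith

end EngineEntropyLedger

/-- **`engine_entropyLedger_fixed` (helper sub-goal of `engine_entropyLedger`): the entropy ledger at fixed `N`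
and `s`** — `EngineEntropyLedger.ledger_fixed` with all parameters explicit (see the module docstring). -/
theorem engine_entropyLedger_fixed : ∀ (σ : ℝ), 0 < σ → σ ≤ 1 / 2 → ∀ (a₀ θ₀ : T3 → ℝ) (u₀ : T3 → V3), Continuous a₀ → Continuous θ₀ → Continuous u₀ → (∀ x, 0 < a₀ x) → (∀ x, 0 < θ₀ x) → ∀ (ρ θ : ℝ → T3 → ℝ) (u : ℝ → T3 → V3) (s : ℝ), (∀ (x : T3) (V : State), Lcl σ ρ θ u s x V = lam0 σ ρ θ u s x * V.1 + (∑ j, lamM θ u s x j * V.2.1 j) + lamE θ s x * V.2.2) → Continuous (Lcl σ ρ θ u s) → Continuous (Ucl ρ θ u s) → (Continuous fun x => hsEntropy σ (Ucl ρ θ u s x)) → Continuous (lam0 σ ρ θ u s) → Continuous (lamM θ u s) → Continuous (lamE θ s) → ∀ (A0 AM AE : ℝ), (∀ x, |lam0 σ ρ θ u s x| ≤ A0) → (∀ x j, |lamM θ u s x j| ≤ AM) → (∀ x, |lamE θ s x| ≤ AE) → ∀ (N : ℕ) (Φ : Flow σ N) (φ : T3 → ℝ), Continuous φ → (∀ y,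 0 ≤ φ y) → ∫ y, φ y = 1 → ∀ (Φb c₁ : ℝ), (∀ y, φ y ≤ Φb) → Φb < ((N + 1 : ℕ) : ℝ) * c₁ → 0 < c₁ → ContinuousOn hsExcessFreeEnergy (Icc (c₁ * σ ^ 3) 1) → ∀ (G : Set (Config (N + 1) (Fin 3) T3)), MeasurableSet G → G ⊆ Φ.good → (∀ z ∈ G, ∀ x, c₁ ≤ bρ φ (Φ.flow s z) x ∧ bρ φ (Φ.flow s z) x * σ ^ 3 ≤ 1) → ∀ (K : ℝ), 0 ≤ K → (∀ w : Config (N + 1) (Fin 3) T3, |(∫ x, Lcl σ ρ θ u s x (bU φ w x)) - obs σ ρ θ u s w| ≤ K * ∫ y, (1 + ‖y.2‖ ^ 2) ∂(empiricalMeasure w)) → ∀ (M₀ : ℝ), Integrable (fun z => (empiricalEnergyField z fun _ => (1 : ℝ)) ^ 2) (localGibbsLaw σ a₀ u₀ θ₀ N Φ) → ∫ z, (empiricalEnergyField z fun _ => (1 : ℝ)) ^ 2 ∂(localGibbsLaw σ a₀ u₀ θ₀ N Φ) ≤ M₀ → Integrable (fun z => G.indicator (fun z => ∫ x, hsEntropy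 σ (bU φ (Φ.flow s z) x)) z) (localGibbsLaw σ a₀ u₀ θ₀ N Φ) → Integrable (fun z => G.indicator (fun z => ∫ x, relEnt σ (bU φ (Φ.flow s z) x) (Ucl ρ θ u s x)) z) (localGibbsLaw σ a₀ u₀ θ₀ N Φ) ∧ Integrable (fun z => G.indicator (fun z => obs σ ρ θ u s (Φ.flow s z) - ∫ x, Lcl σ ρ θ u s x (Ucl ρ θ u s x)) z) (localGibbsLaw σ a₀ u₀ θ₀ N Φ) ∧ (∫ z, G.indicator (fun z => ∫ x, relEnt σ (bU φ (Φ.flow s z) x) (Ucl ρ θ u s x)) z ∂(localGibbsLaw σ a₀ u₀ θ₀ N Φ)) + ∫ z, G.indicator (fun z => obs σ ρ θ u s (Φ.flow s z) - ∫ x, Lcl σ ρ θ u s x (Ucl ρ θ u s x)) z ∂(localGibbsLaw σ a₀ u₀ θ₀ N Φ) ≤ (∫ z, G.indicator (fun z => ∫ x, hsEntropy σ (bU φ (Φ.flow s z) x)) z ∂(localGibbsLaw σ a₀ u₀ θ₀ N Φ)) - (localGibbsLaw σ a₀ u₀ θ₀ N Φ).real G * (∫ x, hsEntropy σ (Ucl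 ρ θ u s x)) + K * (1 + 2 * (M₀ + 1)) :=
  fun _ hσ hσ2 _ _ _ ha hθ hu ha0 hθ0 _ _ _ _ hL hΛc hUc hηU h0c hMc hEc _ _ _ hA0 hAM hAE _ Φ _ hφc hφ0 hφ1 _ _ hφb
      hN hc₁ hfex _ hGm hGgood hGband _ hK hcomm _ he2 hM₀ hIint =>
    EngineEntropyLedger.ledger_fixed hσ hσ2 ha hθ hu ha0 hθ0 hL hΛc hUc hηU h0c hMc hEc hA0 hAM hAE Φ hφc hφ0
      hφ1 hφb hN hc₁ hfex hGm hGgood hGband hK hcomm he2 hM₀ hIint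

end Barycentric

end Summit.AtomisticToContinuum.HydrodynamicLimit.Theorems.MacroClosureLine

end
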